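import Literature.AlgebraicGeometry.HodgeTheory.FermatEigenspaceMultiplicityOne
import Literature.Geometry.ComplexAnalytic.PhamBrieskornJoinEigenvectors
import HarnessLib

/-!
# The character eigenspaces `V(α)` of the Fermat variety vanish when `α ≠ 0` has a zero coordinate (Shioda 1979 §1; Ran 1980 Prop. 1.7 (i))

Family `hodge`, layer `Literature/AlgebraicGeometry/HodgeTheory`. PROOF FILE (theorems only; no
definition, no named fact, D-0026). T. Shioda, *The Hodge conjecture for Fermat varieties*,
Math. Ann. 245 (1979), §1, and Z. Ran, *Cycles on Fermat hypersurfaces*, Compositio Math. 42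
(1980), §1 Prop. 1.7 (i): the primitive cohomology of the Fermat variety `Xⁿₘ` decomposes under
`μₘⁿ⁺²` as `⊕ {V(α) : α ∈ 𝔄ⁿₘ}`, the index set `𝔄ⁿₘ` consisting of the `α = (α₀, …, αₙ₊₁)` with
ALL `αᵢ ≠ 0` (and `Σ αᵢ = 0`); in particular `V(α) = 0` for every `α ≠ 0` having a coordinate
`αᵢ = 0`. In print this is read off the affine pieces `U_k = {x_k ≠ 0} ≃ {Σ zⱼᵐ = 1}`
(Pham 1965; Milnor 1968 §9 Thm. 9.1: the character of the torus `μₘⁿ⁺¹` on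
`H̃ₙ(μₘ * ⋯ * μₘ) = ⊗ H̃₀(μₘ)` is non-trivial on every factor). This file proves it on the
tree's carriers, from the tree's bricks (`FermatEigenspaceMultiplicityOne`: the equivariant lift
of the join `e : J → U_k(ℂ)`, `exists_joinMap`, `diagonalMap_comp_joinMap`, `map_joinMap_injective`,
`kroneckerPairing_map_mem_covariants`) and the vanishing of the covariant functionals of a
character trivial on one factor (`PhamBrieskorn.covariants_eq_bot_of_trivial`,
`Geometry/ComplexAnalytic/PhamBrieskornJoinEigenvectors`):

* `fermatEigenspace_eq_bot_of_injOn` — **abstract form, any dimension `N ≥ 1`, middle degree**: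
  if restriction to `U_k(ℂ)` is injective on `V(α) ⊆ Hᴺ(Xᴺₘ(ℂ); ℂ)` and `α` vanishes at some
  coordinate `k.succAbove j ≠ k`, then `V(α) = 0`;
* `fermatEigenspace_le_span_of_injOn` — under the same injectivity, `dim V(α) ≤ 1` (the tree's
  `exists_le_span_of_equivariant`, recorded with the injectivity as hypothesis so that it serves
  odd dimensions too);
* `fermatEigenspace_eq_bot_of_apply_eq_zero` — **even dimension `2r`, `r ≥ 1`**: for `α ≠ 0`
  with some `αᵢ = 0`, `V(α) ⊆ H²ʳ(X²ʳₘ(ℂ); ℂ)` vanishes (injectivity from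
  `restrictCompl_injOn_fermatEigenspace_middle`, on a chart `k ≠ i`).

## References

* [Shioda1979HodgeFermat] T. Shioda, The Hodge conjecture for Fermat varieties, Math. Ann. 245
  (1979) 175–184, §1.
* [Ran1980] Z. Ran, Cycles on Fermat hypersurfaces, Compositio Math. 42 (1980) 121–142, §1
  Prop. 1.7 (i).
* [Milnor1968] J. Milnor, Singular Points of Complex Hypersurfaces, Ann. of Math. Studies 61
  (1968), §9 Thm. 9.1.
* [Pham1965] F. Pham, Formules de Picard–Lefschetz généralisées et ramification des intégrales,
  Bull. Soc. Math. France 93 (1965) 333–367, §1.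
-/

noncomputable section

open CategoryTheory AlgebraicGeometry

namespace Literature.AlgebraicGeometry.HodgeTheory

open Literature.AlgebraicGeometry.Motives Literature.AlgebraicTopology.SingularHomology
open Literature.Geometry.ComplexAnalytic Literature.Geometry.ComplexAnalytic.PhamBrieskorn

variable {m : ℕ}

/-- `(u₀, …, 1, …, uₙ)` (`1` in slot `k`) with `u = (1, …, ζ, …, 1)` (`ζ` in slot `j`) is
`(1, …, ζ, …, 1)` with `ζ` in slot `k.succAbove j`. [folklore] -/
theorem insertNth_one_mulSingle {N : ℕ} {G : Type*} [DecidableEq (Fin (N + 1))] [DecidableEq (Fin (N + 2))]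
    [One G] (k : Fin (N + 2)) (j : Fin (N + 1)) (ζ : G) :
    (Fin.insertNth k (1 : G) (Pi.mulSingle j ζ) : Fin (N + 2) → G) = Pi.mulSingle (k.succAbove j) ζ := by
  funext i
  refine Fin.succAboveCases k ?_ (fun i' ↦ ?_) i
  · rw [Fin.insertNth_apply_same, Pi.mulSingle_eq_of_ne (Fin.succAbove_ne k j).symm]
  · rw [Fin.insertNth_apply_succAbove]
    by_cases h : i' = j
    · subst h
      rw [Pi.mulSingle_eq_same, Pi.mulSingle_eq_same]
    · rw [Pi.mulSingle_eq_of_ne h, Pi.mulSingle_eq_of_ne (fun h' ↦ h (Fin.succAbove_right_injective h'))]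

/-- **The character `u ↦ χ_α(u₀, …, 1, …, uₙ)` of the torus `μₘᴺ⁺¹` of the chart `U_k` is trivial
on the factor `j` when `α_{k.succAbove j} = 0`.** [cite: Ran1980, §1 Prop. 1.7 (i)] -/
theorem torusCharacter_mulSingle_eq_one {N : ℕ} (k : Fin (N + 2)) {α : Fin (N + 2) → ZMod m}
    {θ : Torus (fun _ : Fin (N + 1) ↦ m) →* ℂˣ}
    (hθ : ∀ u, θ u = fermatCharacter m α (fermatGroupEquiv m (Fin.insertNth k 1 u)))
    (j : Fin (N + 1)) (hj : α (k.succAbove j) = 0) (ζ : rootsOfUnity m ℂ) :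
    θ (Pi.mulSingle j ζ) = 1 := by
  classical
  rw [hθ]
  have h : (Fin.insertNth k (1 : rootsOfUnity m ℂ) (Pi.mulSingle j ζ) : Fin (N + 2) → rootsOfUnity m ℂ) =
      Pi.mulSingle (k.succAbove j) ζ := insertNth_one_mulSingle k j ζ
  have h2 : fermatGroupEquiv m (Fin.insertNth k (1 : rootsOfUnity m ℂ) (Pi.mulSingle j ζ)) =
      fermatGroupSingle (k.succAbove j) ζ := by
    rw [fermatGroupSingle, ← h]
  rw [h2, fermatCharacter_fermatGroupSingle, hj, ZMod.val_zero, pow_zero]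

section Fermat

variable {N : ℕ}

/-- **Abstract vanishing (middle degree, any dimension `N ≥ 1`).** If restriction to the affine
piece `U_k(ℂ)` is injective on `V(α) ⊆ Hᴺ(Xᴺₘ(ℂ); ℂ)` and `α_{k.succAbove j} = 0` for some `j`,
then `V(α) = 0`: along the equivariant lift `e : J → U_k(ℂ)` of the join `μₘ * ⋯ * μₘ`
(`N + 1` factors) the Kronecker dual `⟨e^*(v|_{U_k}), -⟩` of `v ∈ V(α)` is a covariant functional
on `H_N(J; ℂ)` for the character `u ↦ χ_α(u₀, …, 1, …, u_N)`, trivial on the factor `j`; such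
functionals vanish (Milnor Thm. 9.1: the trivial character of `μₘ` does not occur in `H̃₀(μₘ)`),
and `v ↦ e^*(v|_{U_k})` is injective on `V(α)`. [cite: Ran1980, §1 Prop. 1.7 (i)]
[cite: Shioda1979HodgeFermat, §1] [cite: Milnor1968, §9 Thm. 9.1] -/
theorem fermatEigenspace_eq_bot_of_injOn (hN : 1 ≤ N) (hm : m ≠ 0) (k : Fin (N + 2))
    {α : Fin (N + 2) → ZMod m}
    (hinj : Set.InjOn (complexBetti.restrictCompl (fermatHypersurface N m) (fermatCoordHyperplane N m k) N)
      (fermatEigenspace m α N))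
    (j : Fin (N + 1)) (hj : α (k.succAbove j) = 0) :
    fermatEigenspace m α N = ⊥ := by
  obtain ⟨n, rfl⟩ : ∃ n, N = n + 1 := ⟨N - 1, by omega⟩
  obtain ⟨θ, hθ⟩ := exists_torusCharacter_eq (n := n + 1) k α
  obtain ⟨e, he⟩ := exists_joinMap (n := n + 1) hm k
  have hθj : ∀ ζ : rootsOfUnity m ℂ, θ (Pi.mulSingle j ζ) = 1 :=
    torusCharacter_mulSingle_eq_one k hθ j hj
  have hcov := PhamBrieskorn.covariants_eq_bot_of_trivial (n := n) hm j θ hθj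
  rw [eq_bot_iff]
  intro v hv
  rw [Submodule.mem_bot]
  -- the functional `⟨(incl ∘ e)^* v, -⟩` is `θ`-covariant, hence zero
  have hS : ∀ u, singularCohomology.map ℂ ℂ (diagonalMap (fermatPolynomial ℂ (n + 1) m)
      (fermatGroup_le_diagonalStabilizer m (fermatGroupEquiv m (Fin.insertNth k 1 u)).2)) (n + 1) v =
        ((θ u : ℂˣ) : ℂ) • v := by
    intro u
    rw [hθ u]
    exact (mem_fermatEigenspace_iff.mp hv) _
  have hmem := kroneckerPairing_map_mem_covariants
    ((⟨Subtype.val, continuous_subtype_val⟩ :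
      C(complexPointsCompl (fermatHypersurface (n + 1) m) (fermatCoordHyperplane (n + 1) m k),
        ComplexPoints (fermatHypersurface (n + 1) m))).comp e) (n + 1)
    (fun u ↦ diagonalMap (fermatPolynomial ℂ (n + 1) m)
      (fermatGroup_le_diagonalStabilizer m (fermatGroupEquiv m (Fin.insertNth k 1 u)).2))
    (fun u ↦ diagonalMap_comp_joinMap hm k he u) (fun u ↦ ((θ u : ℂˣ) : ℂ)) v hS
  rw [hcov, Submodule.mem_bot] at hmem
  have h1 : singularCohomology.map ℂ ℂ ((⟨Subtype.val, continuous_subtype_val⟩ :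
      C(complexPointsCompl (fermatHypersurface (n + 1) m) (fermatCoordHyperplane (n + 1) m k),
        ComplexPoints (fermatHypersurface (n + 1) m))).comp e) (n + 1) v = 0 :=
    kroneckerPairing_injective_of_field ℂ (join (fun _ : Fin (n + 2) ↦ m)) (n + 1) (by rw [hmem, map_zero])
  rw [singularCohomology.map_comp, ModuleCat.comp_apply] at h1
  have h2 : complexBetti.restrictCompl (fermatHypersurface (n + 1) m) (fermatCoordHyperplane (n + 1) m k) (n + 1) v = 0 :=
    map_joinMap_injective hm k he (n + 1) (by rw [map_zero]; exact h1)
  exact hinj hv (zero_mem _) (by rw [map_zero]; exact h2)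

/-- **Abstract line bound (middle degree, any dimension `N ≥ 1`)**: if restriction to `U_k(ℂ)` is
injective on `V(α) ⊆ Hᴺ(Xᴺₘ(ℂ); ℂ)`, then `dim V(α) ≤ 1` (every character of the torus occurs at
most once in `H_N(J; ℂ)`, `PhamBrieskorn.exists_covariants_le_span`; the tree's
`fermatEigenspace_le_span_of_ne_zero` is the case of even `N` and `α ≠ 0`, where the injectivity
is a theorem). [cite: Ran1980, §1 Prop. 1.7 (i)] [cite: Milnor1968, §9 Thm. 9.1] -/
theorem fermatEigenspace_le_span_of_injOn (hN : 1 ≤ N) (hm : m ≠ 0) (k : Fin (N + 2))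
    {α : Fin (N + 2) → ZMod m}
    (hinj : Set.InjOn (complexBetti.restrictCompl (fermatHypersurface N m) (fermatCoordHyperplane N m k) N)
      (fermatEigenspace m α N)) :
    ∃ v, fermatEigenspace m α N ≤ ℂ ∙ v := by
  have _ := hN
  have ha : ∀ i : Fin (N + 1), (fun _ : Fin (N + 1) ↦ m) i ≠ 0 := fun _ ↦ hm
  obtain ⟨θ, hθ⟩ := exists_torusCharacter_eq (n := N) k α
  obtain ⟨e, he⟩ := exists_joinMap (n := N) hm k
  refine exists_le_span_of_equivariant (T := ComplexPoints (fermatHypersurface N m)) ha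
    ((⟨Subtype.val, continuous_subtype_val⟩ :
      C(complexPointsCompl (fermatHypersurface N m) (fermatCoordHyperplane N m k), ComplexPoints (fermatHypersurface N m))).comp e)
    (fermatEigenspace m α N) ?_
    (fun u ↦ diagonalMap (fermatPolynomial ℂ N m)
      (fermatGroup_le_diagonalStabilizer m (fermatGroupEquiv m (Fin.insertNth k 1 u)).2))
    (fun u ↦ diagonalMap_comp_joinMap hm k he u) θ ?_
  · intro v hv h0
    rw [singularCohomology.map_comp, ModuleCat.comp_apply] at h0
    have h1 : complexBetti.restrictCompl (fermatHypersurface N m) (fermatCoordHyperplane N m k) N v = 0 := by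
      apply map_joinMap_injective hm k he N
      rw [map_zero]
      exact h0
    exact hinj hv (zero_mem _) (by rw [map_zero]; exact h1)
  · intro v hv u
    rw [hθ u]
    exact (mem_fermatEigenspace_iff.mp hv) _

/-- **`V(α) = 0` for `α ≠ 0` with a zero coordinate, in the middle cohomology `H²ʳ(X²ʳₘ(ℂ); ℂ)`
of the even-dimensional Fermat variety** (`r ≥ 1`, `m ≥ 1`): choose a chart `U_k` with `k ≠ i`,
`αᵢ = 0`; restriction to `U_k(ℂ)` is injective on `V(α)` (`restrictCompl_injOn_fermatEigenspace_middle`,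
the kernel being the line of ambient classes on which `μₘ²ʳ⁺²` acts trivially), and the character
of the torus of `U_k` attached to `α` is trivial on the factor `i`. This is the statement
"`Hⁿ_prim(Xⁿₘ) = ⊕_{α ∈ 𝔄ⁿₘ} V(α)` with all `aᵢ ≢ 0`" of Shioda (1.3)/(1.4) in the form `V(α) = 0`
off `𝔄ⁿₘ ∪ {0}`. [cite: Shioda1979HodgeFermat, §1] [cite: Ran1980, §1 Prop. 1.7 (i)] -/
theorem fermatEigenspace_eq_bot_of_apply_eq_zero (hm : 1 ≤ m) {r : ℕ} (hr : 1 ≤ r)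
    {α : Fin (2 * r + 2) → ZMod m} (hα : α ≠ 0) {i : Fin (2 * r + 2)} (hi : α i = 0) :
    fermatEigenspace m α (2 * r) = ⊥ := by
  obtain ⟨k, hk⟩ := exists_ne i
  obtain ⟨j, hj⟩ := Fin.exists_succAbove_eq hk.symm
  exact fermatEigenspace_eq_bot_of_injOn (by omega) (by omega) k
    (restrictCompl_injOn_fermatEigenspace_middle hm hr k hα) j (by rw [hj]; exact hi)

/-- **Contrapositive, the form consumed by the counting arguments**: a non-zero eigenspace
`V(α) ≠ 0` in `H²ʳ(X²ʳₘ(ℂ); ℂ)` (`r, m ≥ 1`) has either `α = 0` or all `αᵢ ≠ 0` (and then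
`Σ αᵢ = 0`, `fermatEigenspace_eq_bot_of_sum_ne_zero`). [cite: Shioda1979HodgeFermat, §1] -/
theorem forall_apply_ne_zero_of_fermatEigenspace_ne_bot (hm : 1 ≤ m) {r : ℕ} (hr : 1 ≤ r)
    {α : Fin (2 * r + 2) → ZMod m} (hα : α ≠ 0) (hV : fermatEigenspace m α (2 * r) ≠ ⊥) :
    ∀ i, α i ≠ 0 :=
  fun _ hi ↦ hV (fermatEigenspace_eq_bot_of_apply_eq_zero hm hr hα hi)

end Fermat

end Literature.AlgebraicGeometry.HodgeTheory

end
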